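import Summits.Ventures.HSemireg.TwoSlotFrameTable
import Summits.Ventures.HSemireg.CliqueUnitKills

/-!
# The clique units with an arbitrary remainder: `T₃(P₁ + 2Z)` on the frame (pub-hsemireg, S4-PUSH corner 2)

Companion of `TwoAdicReadings.lean` §3 (seat s4-search-2 gen 15, cell `pub-hsemireg`; memo
`s4push/search-2/g11/LIFT2-search-2-g11.md` §5 LEMMAS D(b) ∕ E, `CliqueUnitKills.lean`).  `TwoAdicReadings` treats the
clique type (2,2,2,2,3,5) (`T3Z_Km2235_frame`); here are the other six types of record — D(b): (2,2,2,2,4,4),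
(2,2,2,3,3,4) (with (2,2,2,2,3,5): 222 units), E: (1,1,1,1,2,2), (1,1,1,1,1,3), (1,1,1,1,1,2), (1,1,1,1,1,1) (56 units).

**Setting ∕ what is proved** (any commutative ring; frame level — the slots `hᵢ` with `hᵢ² = 0` for `i ∈ S`, the
clique sums `P₁, P₂, P₃` DEFINED from the slots, so that the divided-power law `P₁P₁ = 2P₂`, `P₁P₂ = 3P₃` is
`TwoSlotFrameTable.cliqueSum_* ∕ slotSum_*`; the closed forms `D, D₂, D₃` and the σ-parametrisation `σ₁ = 0`,
`σ₀ = 2s + 1`, `σ₂ = 4t − σ₀`, `σ₃ = 4u` of `CliqueUnitKills`).  Registered expansion at depth 1 (S2-21 §1 (a)):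
the registered `T₃` at `B = P₁ + 2Z` — `T₃Z = σ₃D^[3] − qσ₂D^[2](P₁ + 2Z) + q²σ₁D·E₂ − q³σ₀E₃` with the divided
powers `E₂ = (P₁ + 2Z)^[2] = P₂ + 2P₁Z + 4Z₂`, `E₃ = (P₁ + 2Z)^[3] = P₃ + 2P₂Z + 4P₁Z₂ + 8Z₃` (`Z₂, Z₃` free
parameters standing for `Z^[2], Z^[3]`; the device of `DegreeSixSecondDigit.lemmaB`'s `T₃(B + 4Y)`) — equals
`2^v·(2s + 2u + 1 − 6t)·P₃ + 2^{v′}·(the outside terms of CliqueUnitKills.T3_*) + 2^{v+1}·(explicit remainder terms)`,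
`(v, v′) = (7, 8)` for D(b) (`q = 4`) and `(4, 4)` for E (`q = 2`): every remainder term is divisible by `2^{v+1}`
(`−2qσ₂D₂Z` contributes `−2q³σ₂P₂Z`, `−q³σ₀·2P₂Z` contributes `−2q³σ₀P₂Z`, and `σ₀ + σ₂ = 4t`).  Proofs:
`CliqueUnitKills.T3_*` for the `Z`-free part and `linear_combination` with the cofactors `−2qσ₂Z` (closed form of
`D₂`), `q²D(2P₁Z + 4Z₂)` (`σ₁ = 0`), `−2q³P₂Z` (`σ₂ = 4t − σ₀`).  The READINGS (`T₃(P₁ + 2Z) ∉ 2^{v+1}Λ` in the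
integral exterior algebra, so CRITERION L fails at `k = 3` for every completion — the (V)-kills `(3, 7, 8)` ∕
`(3, 4, 5)` end to end) are `CliqueRemainderReadings.lean`.

Scope ∕ honest framing as in the companions: elementary commutative algebra, theorems only (count-neutral); a
kernel check of pencil steps of a CLASS-LEVEL necessary-condition sieve (CRITERION L) at the special fibre `E⁶`;
no object, no `σ` computation, no Hodge statement; nothing here bears on HC ∕ HC_CM ∕ HC_AV.
-/

namespace Summit.Ventures.HSemireg.CliqueRemainderFrames

variable {R : Type*} [CommRing R]
/-- **LEMMA D(b), type (2,2,2,2,4,4), at `B = P₁ + 2Z` on the frame** (`S` = slots 0–3; `q = 4`).  The registered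
`T₃` at `P₁ + 2Z` (divided powers `E₂, E₃` of `P₁ + 2Z` with free `Z₂, Z₃`) equals
`128·(2s + 2u + 1 − 6t)·P₃ + 256·(outside terms of CliqueUnitKills.T3_Km2244) + 256·(remainder terms)`. -/
theorem T3Z_Km2244_frame (h₀ h₁ h₂ h₃ h₄ h₅ σ₀ σ₁ σ₂ σ₃ s t u P₁ P₂ P₃ D D₂ D₃ Z Z₂ Z₃ E₂ E₃ T₃Z : R)
    (qh₀ : h₀ * h₀ = 0) (qh₁ : h₁ * h₁ = 0) (qh₂ : h₂ * h₂ = 0) (qh₃ : h₃ * h₃ = 0)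
    (hP₁ : P₁ = h₀ + h₁ + h₂ + h₃)
    (hP₂ : P₂ = h₀ * h₁ + h₀ * h₂ + h₀ * h₃ + h₁ * h₂ + h₁ * h₃ + h₂ * h₃)
    (hP₃ : P₃ = h₀ * h₁ * h₂ + h₀ * h₁ * h₃ + h₀ * h₂ * h₃ + h₁ * h₂ * h₃)
    (hD : D = 4 * P₁ + 16 * h₄ + 16 * h₅)
    (hD₂ : D₂ = (256) * h₄ * h₅ + (64) * P₁ * h₅ + (64) * P₁ * h₄ + (16) * P₂)
    (hD₃ : D₃ = (1024) * P₁ * h₄ * h₅ + (256) * P₂ * h₅ + (256) * P₂ * h₄ + (64) * P₃)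
    (hE₂ : E₂ = P₂ + 2 * (P₁ * Z) + 4 * Z₂) (hE₃ : E₃ = P₃ + 2 * (P₂ * Z) + 4 * (P₁ * Z₂) + 8 * Z₃)
    (hT₃Z : T₃Z = σ₃ * D₃ - 4 * σ₂ * (D₂ * (P₁ + 2 * Z)) + 16 * σ₁ * (D * E₂) - 64 * σ₀ * E₃)
    (hσ₁ : σ₁ = 0) (hσ₂ : σ₂ = 4 * t - σ₀) (hσ₀ : σ₀ = 2 * s + 1) (hσ₃ : σ₃ = 4 * u) :
    T₃Z = 128 * ((2 * s + 2 * u + 1 - 6 * t) * P₃) + 256 * ((4) * P₁ * h₄ * h₅ + (16) * P₁ * h₄ * h₅ * u + (-16) *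
      P₁ * h₄ * h₅ * t + (8) * P₁ * h₄ * h₅ * s + (2) * P₂ * h₅ + (4) * P₂ * h₅ * u + (-8) * P₂ * h₅ * t + (4) *
      P₂ * h₅ * s + (2) * P₂ * h₄ + (4) * P₂ * h₄ * u + (-8) * P₂ * h₄ * t + (4) * P₂ * h₄ * s) + 256 * (-(2 * t
      * (P₂ * Z)) - (8 * σ₂ * (h₄ * h₅ * Z) + 2 * σ₂ * (P₁ * h₅ * Z) + 2 * σ₂ * (P₁ * h₄ * Z)) - σ₀ * (P₁ * Z₂)
      - 2 * σ₀ * Z₃) := by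
  have qP₁₁ : P₁ * P₁ = 2 * P₂ := TwoSlotFrameTable.slotSum_11 h₀ h₁ h₂ h₃ P₁ P₂ hP₁ hP₂ qh₀ qh₁ qh₂ qh₃
  have qP₁₂ : P₁ * P₂ = 3 * P₃ := TwoSlotFrameTable.slotSum_12 h₀ h₁ h₂ h₃ P₁ P₂ P₃ hP₁ hP₂ hP₃ qh₀ qh₁ qh₂ qh₃
  have hT := CliqueUnitKills.T3_Km2244 h₄ h₅ σ₀ σ₁ σ₂ σ₃ s t u P₁ P₂ P₃ D D₂ D₃ _ rfl hD hD₂ hD₃ qP₁₁ qP₁₂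
    hσ₁ hσ₂ hσ₀ hσ₃
  subst hE₂ hE₃ hT₃Z
  linear_combination hT + (-8 * σ₂ * Z) * hD₂ + (16 * D * (2 * (P₁ * Z) + 4 * Z₂)) * hσ₁
    + (-128 * (P₂ * Z)) * hσ₂

/-- **LEMMA D(b), type (2,2,2,3,3,4), at `B = P₁ + 2Z` on the frame** (`S` = slots 0–2; `q = 4`).  The registered
`T₃` at `P₁ + 2Z` (divided powers `E₂, E₃` of `P₁ + 2Z` with free `Z₂, Z₃`) equals
`128·(2s + 2u + 1 − 6t)·P₃ + 256·(outside terms of CliqueUnitKills.T3_Km2334) + 256·(remainder terms)`. -/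
theorem T3Z_Km2334_frame (h₀ h₁ h₂ h₃ h₄ h₅ σ₀ σ₁ σ₂ σ₃ s t u P₁ P₂ P₃ D D₂ D₃ Z Z₂ Z₃ E₂ E₃ T₃Z : R)
    (qh₀ : h₀ * h₀ = 0) (qh₁ : h₁ * h₁ = 0) (qh₂ : h₂ * h₂ = 0)
    (hP₁ : P₁ = h₀ + h₁ + h₂)
    (hP₂ : P₂ = h₀ * h₁ + h₀ * h₂ + h₁ * h₂)
    (hP₃ : P₃ = h₀ * h₁ * h₂)
    (hD : D = 4 * P₁ + 8 * h₃ + 8 * h₄ + 16 * h₅)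
    (hD₂ : D₂ = (128) * h₄ * h₅ + (128) * h₃ * h₅ + (64) * h₃ * h₄ + (64) * P₁ * h₅ + (32) * P₁ * h₄ + (32) * P₁ *
      h₃ + (16) * P₂)
    (hD₃ : D₃ = (1024) * h₃ * h₄ * h₅ + (512) * P₁ * h₄ * h₅ + (512) * P₁ * h₃ * h₅ + (256) * P₁ * h₃ * h₄ + (256) *
      P₂ * h₅ + (128) * P₂ * h₄ + (128) * P₂ * h₃ + (64) * P₃)
    (hE₂ : E₂ = P₂ + 2 * (P₁ * Z) + 4 * Z₂) (hE₃ : E₃ = P₃ + 2 * (P₂ * Z) + 4 * (P₁ * Z₂) + 8 * Z₃)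
    (hT₃Z : T₃Z = σ₃ * D₃ - 4 * σ₂ * (D₂ * (P₁ + 2 * Z)) + 16 * σ₁ * (D * E₂) - 64 * σ₀ * E₃)
    (hσ₁ : σ₁ = 0) (hσ₂ : σ₂ = 4 * t - σ₀) (hσ₀ : σ₀ = 2 * s + 1) (hσ₃ : σ₃ = 4 * u) :
    T₃Z = 128 * ((2 * s + 2 * u + 1 - 6 * t) * P₃) + 256 * ((16) * h₃ * h₄ * h₅ * u + (2) * P₁ * h₄ * h₅ + (8) * P₁
      * h₄ * h₅ * u + (-8) * P₁ * h₄ * h₅ * t + (4) * P₁ * h₄ * h₅ * s + (2) * P₁ * h₃ * h₅ + (8) * P₁ * h₃ * h₅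
      * u + (-8) * P₁ * h₃ * h₅ * t + (4) * P₁ * h₃ * h₅ * s + P₁ * h₃ * h₄ + (4) * P₁ * h₃ * h₄ * u + (-4) * P₁
      * h₃ * h₄ * t + (2) * P₁ * h₃ * h₄ * s + (2) * P₂ * h₅ + (4) * P₂ * h₅ * u + (-8) * P₂ * h₅ * t + (4) * P₂
      * h₅ * s + P₂ * h₄ + (2) * P₂ * h₄ * u + (-4) * P₂ * h₄ * t + (2) * P₂ * h₄ * s + P₂ * h₃ + (2) * P₂ * h₃
      * u + (-4) * P₂ * h₃ * t + (2) * P₂ * h₃ * s) + 256 * (-(2 * t * (P₂ * Z)) - (4 * σ₂ * (h₄ * h₅ * Z) + 4 *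
      σ₂ * (h₃ * h₅ * Z) + 2 * σ₂ * (h₃ * h₄ * Z) + 2 * σ₂ * (P₁ * h₅ * Z) + σ₂ * (P₁ * h₄ * Z) + σ₂ * (P₁ * h₃
      * Z)) - σ₀ * (P₁ * Z₂) - 2 * σ₀ * Z₃) := by
  have qP₁₁ : P₁ * P₁ = 2 * P₂ := TwoSlotFrameTable.cliqueSum_11_3 h₀ h₁ h₂ P₁ P₂ hP₁ hP₂ qh₀ qh₁ qh₂
  have qP₁₂ : P₁ * P₂ = 3 * P₃ := TwoSlotFrameTable.cliqueSum_12_3 h₀ h₁ h₂ P₁ P₂ P₃ hP₁ hP₂ hP₃ qh₀ qh₁ qh₂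
  have hT := CliqueUnitKills.T3_Km2334 h₃ h₄ h₅ σ₀ σ₁ σ₂ σ₃ s t u P₁ P₂ P₃ D D₂ D₃ _ rfl hD hD₂ hD₃ qP₁₁ qP₁₂
    hσ₁ hσ₂ hσ₀ hσ₃
  subst hE₂ hE₃ hT₃Z
  linear_combination hT + (-8 * σ₂ * Z) * hD₂ + (16 * D * (2 * (P₁ * Z) + 4 * Z₂)) * hσ₁
    + (-128 * (P₂ * Z)) * hσ₂

/-- **LEMMA E, type (1,1,1,1,2,2), at `B = P₁ + 2Z` on the frame** (`S` = slots 0–3; `q = 2`).  The registered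
`T₃` at `P₁ + 2Z` (divided powers `E₂, E₃` of `P₁ + 2Z` with free `Z₂, Z₃`) equals
`16·(2s + 2u + 1 − 6t)·P₃ + 16·(outside terms of CliqueUnitKills.T3_Km1122) + 32·(remainder terms)`. -/
theorem T3Z_Km1122_frame (h₀ h₁ h₂ h₃ h₄ h₅ σ₀ σ₁ σ₂ σ₃ s t u P₁ P₂ P₃ D D₂ D₃ Z Z₂ Z₃ E₂ E₃ T₃Z : R)
    (qh₀ : h₀ * h₀ = 0) (qh₁ : h₁ * h₁ = 0) (qh₂ : h₂ * h₂ = 0) (qh₃ : h₃ * h₃ = 0)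
    (hP₁ : P₁ = h₀ + h₁ + h₂ + h₃)
    (hP₂ : P₂ = h₀ * h₁ + h₀ * h₂ + h₀ * h₃ + h₁ * h₂ + h₁ * h₃ + h₂ * h₃)
    (hP₃ : P₃ = h₀ * h₁ * h₂ + h₀ * h₁ * h₃ + h₀ * h₂ * h₃ + h₁ * h₂ * h₃)
    (hD : D = 2 * P₁ + 4 * h₄ + 4 * h₅)
    (hD₂ : D₂ = (16) * h₄ * h₅ + (8) * P₁ * h₅ + (8) * P₁ * h₄ + (4) * P₂)
    (hD₃ : D₃ = (32) * P₁ * h₄ * h₅ + (16) * P₂ * h₅ + (16) * P₂ * h₄ + (8) * P₃)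
    (hE₂ : E₂ = P₂ + 2 * (P₁ * Z) + 4 * Z₂) (hE₃ : E₃ = P₃ + 2 * (P₂ * Z) + 4 * (P₁ * Z₂) + 8 * Z₃)
    (hT₃Z : T₃Z = σ₃ * D₃ - 2 * σ₂ * (D₂ * (P₁ + 2 * Z)) + 4 * σ₁ * (D * E₂) - 8 * σ₀ * E₃)
    (hσ₁ : σ₁ = 0) (hσ₂ : σ₂ = 4 * t - σ₀) (hσ₀ : σ₀ = 2 * s + 1) (hσ₃ : σ₃ = 4 * u) :
    T₃Z = 16 * ((2 * s + 2 * u + 1 - 6 * t) * P₃) + 16 * ((2) * P₁ * h₄ * h₅ + (8) * P₁ * h₄ * h₅ * u + (-8) * P₁ *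
      h₄ * h₅ * t + (4) * P₁ * h₄ * h₅ * s + (2) * P₂ * h₅ + (4) * P₂ * h₅ * u + (-8) * P₂ * h₅ * t + (4) * P₂ *
      h₅ * s + (2) * P₂ * h₄ + (4) * P₂ * h₄ * u + (-8) * P₂ * h₄ * t + (4) * P₂ * h₄ * s) + 32 * (-(2 * t * (P₂
      * Z)) - (2 * σ₂ * (h₄ * h₅ * Z) + σ₂ * (P₁ * h₅ * Z) + σ₂ * (P₁ * h₄ * Z)) - σ₀ * (P₁ * Z₂) - 2 * σ₀ * Z₃) := by
  have qP₁₁ : P₁ * P₁ = 2 * P₂ := TwoSlotFrameTable.slotSum_11 h₀ h₁ h₂ h₃ P₁ P₂ hP₁ hP₂ qh₀ qh₁ qh₂ qh₃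
  have qP₁₂ : P₁ * P₂ = 3 * P₃ := TwoSlotFrameTable.slotSum_12 h₀ h₁ h₂ h₃ P₁ P₂ P₃ hP₁ hP₂ hP₃ qh₀ qh₁ qh₂ qh₃
  have hT := CliqueUnitKills.T3_Km1122 h₄ h₅ σ₀ σ₁ σ₂ σ₃ s t u P₁ P₂ P₃ D D₂ D₃ _ rfl hD hD₂ hD₃ qP₁₁ qP₁₂
    hσ₁ hσ₂ hσ₀ hσ₃
  subst hE₂ hE₃ hT₃Z
  linear_combination hT + (-4 * σ₂ * Z) * hD₂ + (4 * D * (2 * (P₁ * Z) + 4 * Z₂)) * hσ₁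
    + (-16 * (P₂ * Z)) * hσ₂

/-- **LEMMA E, type (1,1,1,1,1,3), at `B = P₁ + 2Z` on the frame** (`S` = slots 0–4; `q = 2`).  The registered
`T₃` at `P₁ + 2Z` (divided powers `E₂, E₃` of `P₁ + 2Z` with free `Z₂, Z₃`) equals
`16·(2s + 2u + 1 − 6t)·P₃ + 16·(outside terms of CliqueUnitKills.T3_Km11113) + 32·(remainder terms)`. -/
theorem T3Z_Km11113_frame (h₀ h₁ h₂ h₃ h₄ h₅ σ₀ σ₁ σ₂ σ₃ s t u P₁ P₂ P₃ D D₂ D₃ Z Z₂ Z₃ E₂ E₃ T₃Z : R)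
    (qh₀ : h₀ * h₀ = 0) (qh₁ : h₁ * h₁ = 0) (qh₂ : h₂ * h₂ = 0) (qh₃ : h₃ * h₃ = 0) (qh₄ : h₄ * h₄ = 0)
    (hP₁ : P₁ = h₀ + h₁ + h₂ + h₃ + h₄)
    (hP₂ : P₂ = h₀ * h₁ + h₀ * h₂ + h₀ * h₃ + h₀ * h₄ + h₁ * h₂ + h₁ * h₃ + h₁ * h₄ + h₂ * h₃ + h₂ * h₄ + h₃ * h₄)
    (hP₃ : P₃ = h₀ * h₁ * h₂ + h₀ * h₁ * h₃ + h₀ * h₁ * h₄ + h₀ * h₂ * h₃ + h₀ * h₂ * h₄ + h₀ * h₃ * h₄ + h₁ * h₂ *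
      h₃ + h₁ * h₂ * h₄ + h₁ * h₃ * h₄ + h₂ * h₃ * h₄)
    (hD : D = 2 * P₁ + 8 * h₅)
    (hD₂ : D₂ = (16) * P₁ * h₅ + (4) * P₂)
    (hD₃ : D₃ = (32) * P₂ * h₅ + (8) * P₃)
    (hE₂ : E₂ = P₂ + 2 * (P₁ * Z) + 4 * Z₂) (hE₃ : E₃ = P₃ + 2 * (P₂ * Z) + 4 * (P₁ * Z₂) + 8 * Z₃)
    (hT₃Z : T₃Z = σ₃ * D₃ - 2 * σ₂ * (D₂ * (P₁ + 2 * Z)) + 4 * σ₁ * (D * E₂) - 8 * σ₀ * E₃)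
    (hσ₁ : σ₁ = 0) (hσ₂ : σ₂ = 4 * t - σ₀) (hσ₀ : σ₀ = 2 * s + 1) (hσ₃ : σ₃ = 4 * u) :
    T₃Z = 16 * ((2 * s + 2 * u + 1 - 6 * t) * P₃) + 16 * ((4) * P₂ * h₅ + (8) * P₂ * h₅ * u + (-16) * P₂ * h₅ * t +
      (8) * P₂ * h₅ * s) + 32 * (-(2 * t * (P₂ * Z)) - (2 * σ₂ * (P₁ * h₅ * Z)) - σ₀ * (P₁ * Z₂) - 2 * σ₀ * Z₃) := by
  have qP₁₁ : P₁ * P₁ = 2 * P₂ := TwoSlotFrameTable.cliqueSum_11_5 h₀ h₁ h₂ h₃ h₄ P₁ P₂ hP₁ hP₂ qh₀ qh₁ qh₂ qh₃ qh₄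
  have qP₁₂ : P₁ * P₂ = 3 * P₃ := TwoSlotFrameTable.cliqueSum_12_5 h₀ h₁ h₂ h₃ h₄ P₁ P₂ P₃ hP₁ hP₂ hP₃ qh₀ qh₁ qh₂ qh₃ qh₄
  have hT := CliqueUnitKills.T3_Km11113 h₅ σ₀ σ₁ σ₂ σ₃ s t u P₁ P₂ P₃ D D₂ D₃ _ rfl hD hD₂ hD₃ qP₁₁ qP₁₂
    hσ₁ hσ₂ hσ₀ hσ₃
  subst hE₂ hE₃ hT₃Z
  linear_combination hT + (-4 * σ₂ * Z) * hD₂ + (4 * D * (2 * (P₁ * Z) + 4 * Z₂)) * hσ₁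
    + (-16 * (P₂ * Z)) * hσ₂

/-- **LEMMA E, type (1,1,1,1,1,2), at `B = P₁ + 2Z` on the frame** (`S` = slots 0–4; `q = 2`).  The registered
`T₃` at `P₁ + 2Z` (divided powers `E₂, E₃` of `P₁ + 2Z` with free `Z₂, Z₃`) equals
`16·(2s + 2u + 1 − 6t)·P₃ + 16·(outside terms of CliqueUnitKills.T3_Km11112) + 32·(remainder terms)`. -/
theorem T3Z_Km11112_frame (h₀ h₁ h₂ h₃ h₄ h₅ σ₀ σ₁ σ₂ σ₃ s t u P₁ P₂ P₃ D D₂ D₃ Z Z₂ Z₃ E₂ E₃ T₃Z : R)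
    (qh₀ : h₀ * h₀ = 0) (qh₁ : h₁ * h₁ = 0) (qh₂ : h₂ * h₂ = 0) (qh₃ : h₃ * h₃ = 0) (qh₄ : h₄ * h₄ = 0)
    (hP₁ : P₁ = h₀ + h₁ + h₂ + h₃ + h₄)
    (hP₂ : P₂ = h₀ * h₁ + h₀ * h₂ + h₀ * h₃ + h₀ * h₄ + h₁ * h₂ + h₁ * h₃ + h₁ * h₄ + h₂ * h₃ + h₂ * h₄ + h₃ * h₄)
    (hP₃ : P₃ = h₀ * h₁ * h₂ + h₀ * h₁ * h₃ + h₀ * h₁ * h₄ + h₀ * h₂ * h₃ + h₀ * h₂ * h₄ + h₀ * h₃ * h₄ + h₁ * h₂ *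
      h₃ + h₁ * h₂ * h₄ + h₁ * h₃ * h₄ + h₂ * h₃ * h₄)
    (hD : D = 2 * P₁ + 4 * h₅)
    (hD₂ : D₂ = (8) * P₁ * h₅ + (4) * P₂)
    (hD₃ : D₃ = (16) * P₂ * h₅ + (8) * P₃)
    (hE₂ : E₂ = P₂ + 2 * (P₁ * Z) + 4 * Z₂) (hE₃ : E₃ = P₃ + 2 * (P₂ * Z) + 4 * (P₁ * Z₂) + 8 * Z₃)
    (hT₃Z : T₃Z = σ₃ * D₃ - 2 * σ₂ * (D₂ * (P₁ + 2 * Z)) + 4 * σ₁ * (D * E₂) - 8 * σ₀ * E₃)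
    (hσ₁ : σ₁ = 0) (hσ₂ : σ₂ = 4 * t - σ₀) (hσ₀ : σ₀ = 2 * s + 1) (hσ₃ : σ₃ = 4 * u) :
    T₃Z = 16 * ((2 * s + 2 * u + 1 - 6 * t) * P₃) + 16 * ((2) * P₂ * h₅ + (4) * P₂ * h₅ * u + (-8) * P₂ * h₅ * t +
      (4) * P₂ * h₅ * s) + 32 * (-(2 * t * (P₂ * Z)) - (σ₂ * (P₁ * h₅ * Z)) - σ₀ * (P₁ * Z₂) - 2 * σ₀ * Z₃) := by
  have qP₁₁ : P₁ * P₁ = 2 * P₂ := TwoSlotFrameTable.cliqueSum_11_5 h₀ h₁ h₂ h₃ h₄ P₁ P₂ hP₁ hP₂ qh₀ qh₁ qh₂ qh₃ qh₄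
  have qP₁₂ : P₁ * P₂ = 3 * P₃ := TwoSlotFrameTable.cliqueSum_12_5 h₀ h₁ h₂ h₃ h₄ P₁ P₂ P₃ hP₁ hP₂ hP₃ qh₀ qh₁ qh₂ qh₃ qh₄
  have hT := CliqueUnitKills.T3_Km11112 h₅ σ₀ σ₁ σ₂ σ₃ s t u P₁ P₂ P₃ D D₂ D₃ _ rfl hD hD₂ hD₃ qP₁₁ qP₁₂
    hσ₁ hσ₂ hσ₀ hσ₃
  subst hE₂ hE₃ hT₃Z
  linear_combination hT + (-4 * σ₂ * Z) * hD₂ + (4 * D * (2 * (P₁ * Z) + 4 * Z₂)) * hσ₁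
    + (-16 * (P₂ * Z)) * hσ₂

/-- **LEMMA E, type (1,1,1,1,1,1), at `B = P₁ + 2Z` on the frame** (`S` = slots 0–5; `q = 2`).  The registered
`T₃` at `P₁ + 2Z` (divided powers `E₂, E₃` of `P₁ + 2Z` with free `Z₂, Z₃`) equals
`16·(2s + 2u + 1 − 6t)·P₃ + 16·(outside terms of CliqueUnitKills.T3_Km111111) + 32·(remainder terms)`. -/
theorem T3Z_Km111111_frame (h₀ h₁ h₂ h₃ h₄ h₅ σ₀ σ₁ σ₂ σ₃ s t u P₁ P₂ P₃ D D₂ D₃ Z Z₂ Z₃ E₂ E₃ T₃Z : R)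
    (qh₀ : h₀ * h₀ = 0) (qh₁ : h₁ * h₁ = 0) (qh₂ : h₂ * h₂ = 0) (qh₃ : h₃ * h₃ = 0) (qh₄ : h₄ * h₄ = 0) (qh₅ : h₅ *
    h₅ = 0)
    (hP₁ : P₁ = h₀ + h₁ + h₂ + h₃ + h₄ + h₅)
    (hP₂ : P₂ = h₀ * h₁ + h₀ * h₂ + h₀ * h₃ + h₀ * h₄ + h₀ * h₅ + h₁ * h₂ + h₁ * h₃ + h₁ * h₄ + h₁ * h₅ + h₂ * h₃ +
      h₂ * h₄ + h₂ * h₅ + h₃ * h₄ + h₃ * h₅ + h₄ * h₅)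
    (hP₃ : P₃ = h₀ * h₁ * h₂ + h₀ * h₁ * h₃ + h₀ * h₁ * h₄ + h₀ * h₁ * h₅ + h₀ * h₂ * h₃ + h₀ * h₂ * h₄ + h₀ * h₂ *
      h₅ + h₀ * h₃ * h₄ + h₀ * h₃ * h₅ + h₀ * h₄ * h₅ + h₁ * h₂ * h₃ + h₁ * h₂ * h₄ + h₁ * h₂ * h₅ + h₁ * h₃ *
      h₄ + h₁ * h₃ * h₅ + h₁ * h₄ * h₅ + h₂ * h₃ * h₄ + h₂ * h₃ * h₅ + h₂ * h₄ * h₅ + h₃ * h₄ * h₅)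
    (hD : D = 2 * P₁)
    (hD₂ : D₂ = (4) * P₂)
    (hD₃ : D₃ = (8) * P₃)
    (hE₂ : E₂ = P₂ + 2 * (P₁ * Z) + 4 * Z₂) (hE₃ : E₃ = P₃ + 2 * (P₂ * Z) + 4 * (P₁ * Z₂) + 8 * Z₃)
    (hT₃Z : T₃Z = σ₃ * D₃ - 2 * σ₂ * (D₂ * (P₁ + 2 * Z)) + 4 * σ₁ * (D * E₂) - 8 * σ₀ * E₃)
    (hσ₁ : σ₁ = 0) (hσ₂ : σ₂ = 4 * t - σ₀) (hσ₀ : σ₀ = 2 * s + 1) (hσ₃ : σ₃ = 4 * u) :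
    T₃Z = 16 * ((2 * s + 2 * u + 1 - 6 * t) * P₃) + 16 * (0) + 32 * (-(2 * t * (P₂ * Z)) - σ₀ * (P₁ * Z₂) - 2 * σ₀ *
      Z₃) := by
  have qP₁₂ : P₁ * P₂ = 3 * P₃ := TwoSlotFrameTable.cliqueSum_12_6 h₀ h₁ h₂ h₃ h₄ h₅ P₁ P₂ P₃ hP₁ hP₂ hP₃ qh₀ qh₁ qh₂ qh₃ qh₄ qh₅
  have hT := CliqueUnitKills.T3_Km111111  σ₀ σ₁ σ₂ σ₃ s t u P₁ P₂ P₃ D D₂ D₃ _ rfl hD hD₂ hD₃ qP₁₂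
    hσ₁ hσ₂ hσ₀ hσ₃
  subst hE₂ hE₃ hT₃Z
  linear_combination hT + (-4 * σ₂ * Z) * hD₂ + (4 * D * (2 * (P₁ * Z) + 4 * Z₂)) * hσ₁
    + (-16 * (P₂ * Z)) * hσ₂

end Summit.Ventures.HSemireg.CliqueRemainderFrames
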